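import Literature.Geometry.Riemannian.ExpMapIndexNonneg
import Literature.Geometry.Riemannian.NonTrappingConvexSublevelProofs
import Literature.Geometry.Riemannian.TensionFieldSmooth
import HarnessLib

/-!
# Brendle's ABP method, first and second variation at a contact point
# (Brendle, CPAM 76 (2023), Lemmas 2.2 and 2.3)

Topic `Geometry/Riemannian`. Let `γ` be a geodesic of a complete smooth Riemannian manifold,
`r > 0`, `X` a smooth vector field along `γ` with `X(r) = 0`, and `u` a function of class `C²`
near `γ(0)`. Consider the variation `x_σ(t) = exp_{γ(t)}(σ X(t))` (so `x_σ(r) = γ(r)`) and the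
functional `Ψ(σ) = r u(x_σ(0)) + ½ r ∫₀ʳ |∂ₜ x_σ|²`. If `Ψ(0) ≤ Ψ(σ)` for all small `σ` (for `X`
and for `-X`), then

* `du_{γ(0)}(X(0)) = g(X(0), γ'(0))` (first variation; Brendle 2023, Lemma 2.2:
  "`∇u(x̄) = γ̄'(0)`"),
* `0 ≤ Hess u(X(0), X(0)) + ∫₀ʳ (|D_t X|² − R(γ', X, γ', X)) dt` (second variation; Brendle 2023,
  Lemma 2.3, with `g(R(X,γ')X,γ') = −R(γ',X,γ',X)` in the tree's curvature convention)

— `mvfderiv_eq_and_secondVariation_nonneg_of_minimal`, from the one-sided expansion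
`firstOrder_and_secondVariation_of_minimal`. The minimality hypothesis is supplied, exactly as in
Brendle's proof ("`r u(x) + ½ d(x,p)² ≥ r u(x̄) + ½ d(x̄,p)²` for `x` near `x̄`,
`d(x̄, p) = r|γ̄'(0)|`,
`d(x_σ(0), p) ≤ L(x_σ) ≤ (r E(x_σ))^{1/2}`"), by `eventually_energy_minimal_of_contact`.

Proof: the tree's second-order Taylor bound for the energy of the variation
(`integral_energy_le_taylor`, Lee 2018 Thm. 6.3/10.22 in energy form), the closed form of the
first-order term `∫ 2 g(D_tX, γ') = −2 g(X(0), γ'(0))`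
(`integral_val_covariantDerivAlong_velocity`),
and a second-order Taylor bound for `σ ↦ u(exp_{γ(0)}(σ X(0)))` whose derivatives at `0` are
`du(X(0))` and `Hess u(X(0), X(0))` (`hasDerivAt_comp_curve_mvfderiv`,
`hasDerivAt_mvfderiv_velocity_of_isGeodesicOn`); comparing the coefficients of `σ` and `σ²`.
These are steps R2–R3 of the geometric (PDE-free) half of Brendle's ABP estimate used for
`sharpLogSobolevAVR_four` (see `ABPJacobianComparison.lean`, `ABPNoConjugate.lean`).
Pure proofs; no definitions, no named facts.

## References

* [Brendle2022] S. Brendle, *Sobolev inequalities in manifolds with nonnegative curvature*,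
  Comm. Pure Appl. Math. 76 (2023) 2192–2218 (arXiv:2009.13717), §2, Lemmas 2.1–2.3. READ
  (arXiv v2, pp. 4–6).
* J. M. Lee, *Introduction to Riemannian Manifolds*, 2nd ed. (2018), Thm. 6.3, Thm. 10.22.
  [LeeRiemannianManifolds2018]
-/

noncomputable section

open Bundle Set Filter Function MeasureTheory
open scoped Manifold ContDiff Topology

namespace Literature.Geometry.Riemannian

open Literature.Geometry.Lorentzian
open Literature.Geometry.Lorentzian.PseudoRiemannianMetric

/-! ### Two elementary real-variable lemmas -/

/-- If `0 ≤ a + σ b` for all `σ ∈ (0, δ]`, then `0 ≤ a` (let `σ → 0⁺`). [folklore] -/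
theorem nonneg_of_forall_Ioc_nonneg_add_mul {a b δ : ℝ} (hδ : 0 < δ)
    (h : ∀ σ ∈ Ioc 0 δ, 0 ≤ a + σ * b) : 0 ≤ a := by
  have ht : Tendsto (fun σ : ℝ ↦ a + σ * b) (𝓝[>] 0) (𝓝 a) := by
    have : Tendsto (fun σ : ℝ ↦ a + σ * b) (𝓝 0) (𝓝 (a + 0 * b)) :=
      (continuous_const.add (continuous_id.mul continuous_const)).tendsto 0
    rw [zero_mul, add_zero] at this
    exact this.mono_left nhdsWithin_le_nhds
  exact ge_of_tendsto ht (by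
    filter_upwards [Ioc_mem_nhdsGT hδ] with σ hσ using h σ hσ)

/-- **One-sided second-order Taylor bound**: if `k` has derivative `k'` on `[0, δ₁]` and `k'` is
differentiable at `0` with derivative `H`, then for every `ε > 0`,
`k(σ) ≤ k(0) + σ k'(0) + (σ²/2)(H + ε)` for all small `σ ≥ 0` (the defect has nonpositive
derivative `k'(σ) - k'(0) - σ(H + ε) ≤ 0` near `0⁺`). Elementary calculus. [folklore] -/
theorem exists_le_taylor_two_of_hasDerivAt {k k' : ℝ → ℝ} {H δ₁ : ℝ} (hδ₁ : 0 < δ₁)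
    (hk : ∀ σ ∈ Icc 0 δ₁, HasDerivAt k (k' σ) σ) (hk' : HasDerivAt k' H 0) {ε : ℝ} (hε : 0 < ε) :
    ∃ δ > 0, ∀ σ ∈ Icc 0 δ, k σ ≤ k 0 + σ * k' 0 + σ ^ 2 / 2 * (H + ε) := by
  -- `k'(ξ) ≤ k'(0) + ξ (H + ε)` for small `ξ ≥ 0`
  have hev : ∀ᶠ ξ in 𝓝 (0 : ℝ), ‖k' ξ - k' 0 - (ξ - 0) • H‖ ≤ ε * ‖ξ - 0‖ :=
    (hasDerivAt_iff_isLittleO.1 hk').def hε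
  obtain ⟨δ₂, hδ₂, hδ₂b⟩ := Metric.eventually_nhds_iff.1 hev
  set δ := min δ₁ (δ₂ / 2) with hδ_def
  have hδ : 0 < δ := lt_min hδ₁ (by linarith)
  have hδδ₁ : δ ≤ δ₁ := min_le_left _ _
  have hδδ₂ : δ < δ₂ := lt_of_le_of_lt (min_le_right _ _) (by linarith)
  refine ⟨δ, hδ, fun σ hσ ↦ ?_⟩
  have hslope : ∀ ξ ∈ Icc 0 δ, k' ξ ≤ k' 0 + ξ * (H + ε) := by
    intro ξ hξ
    have h1 := hδ₂b (show dist ξ 0 < δ₂ by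
      rw [Real.dist_eq, sub_zero, abs_of_nonneg hξ.1]; exact lt_of_le_of_lt hξ.2 hδδ₂)
    simp only [sub_zero, smul_eq_mul, Real.norm_eq_abs, abs_of_nonneg hξ.1] at h1
    have h2 := (abs_le.1 h1).2
    nlinarith
  -- the defect `φ(σ) = k σ - k 0 - σ k'(0) - σ²/2 (H + ε)` is nonincreasing on `[0, δ]`
  have hφd : ∀ ξ ∈ Icc 0 δ, HasDerivAt (fun ξ ↦ k ξ - ξ * k' 0 - ξ ^ 2 / 2 * (H + ε) - k 0)
      (k' ξ - k' 0 - ξ * (H + ε)) ξ := fun ξ hξ ↦ by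
    have h1 := (((hk ξ ⟨hξ.1, hξ.2.trans hδδ₁⟩).sub (hasDerivAt_mul_const (k' 0))).sub
      ((((hasDerivAt_id' ξ).pow 2).div_const 2).mul_const (H + ε))).sub_const (k 0)
    refine h1.congr_deriv ?_
    push_cast
    ring
  have hanti : AntitoneOn (fun ξ ↦ k ξ - ξ * k' 0 - ξ ^ 2 / 2 * (H + ε) - k 0) (Icc 0 δ) := by
    refine antitoneOn_of_deriv_nonpos (convex_Icc 0 δ)
      (fun ξ hξ ↦ (hφd ξ hξ).continuousAt.continuousWithinAt)
      (fun ξ hξ ↦ (hφd ξ (interior_subset hξ)).differentiableAt.differentiableWithinAt) ?_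
    intro ξ hξ
    rw [interior_Icc] at hξ
    rw [(hφd ξ ⟨hξ.1.le, hξ.2.le⟩).deriv]
    have := hslope ξ ⟨hξ.1.le, hξ.2.le⟩
    linarith
  have h0 := hanti ⟨le_rfl, hδ.le⟩ hσ hσ.1
  simp only at h0
  nlinarith [h0]


/-! ### The second variation inequality from minimality -/

section SecondVariation

variable {E : Type*} [NormedAddCommGroup E] [NormedSpace ℝ E] {H : Type*} [TopologicalSpace H]
  {I : ModelWithCorners ℝ E H} {M : Type*} [TopologicalSpace M] [ChartedSpace H M]
  [IsManifold I ∞ M] {n : ℕ∞ω} [FiniteDimensional ℝ E] [CompleteSpace E]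
  (g : PseudoRiemannianMetric I n E (TangentSpace I : M → Type _)) [g.HasLeviCivita]
  [T2Space M] [BoundarylessManifold I M]
  [CovariantDerivative.ContMDiffCovariantDerivative g.leviCivita 1]
  [CovariantDerivative.ContMDiffCovariantDerivative g.leviCivita ∞]

omit [FiniteDimensional ℝ E] [CompleteSpace E] [T2Space M] [BoundarylessManifold I M]
  [CovariantDerivative.ContMDiffCovariantDerivative g.leviCivita 1]
  [CovariantDerivative.ContMDiffCovariantDerivative g.leviCivita ∞] in
/-- Transport of `du` and `Hess u` along an equality of base points (all tangent spaces are the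
model space `E`). [folklore] -/
theorem mvfderiv_hessian_congr_point {u : M → ℝ} {q q' : M} (hq : q = q') {v v' : E}
    (hv : v = v') :
    mvfderiv I u q (show TangentSpace I q from v) =
        mvfderiv I u q' (show TangentSpace I q' from v') ∧
      g.hessian u q (show TangentSpace I q from v) (show TangentSpace I q from v) =
        g.hessian u q' (show TangentSpace I q' from v') (show TangentSpace I q' from v') := by
  subst hq; subst hv; exact ⟨rfl, rfl⟩

set_option maxHeartbeats 800000 in
/-- **One-sided first and second variation at a contact point** (Brendle 2023, proofs of
Lemmas 2.2 and 2.3). Let `γ` be a smooth geodesic of a complete smooth metric, `X` a smooth field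
along `γ` with `X(r) = 0` (`r > 0`), `u` of class `C²` near `γ(0)`, and suppose that
`Ψ(σ) = r u(exp_{γ(0)}(σX(0))) + ½ r ∫₀ʳ |∂ₜ exp_{γ(t)}(σX(t))|² dt` satisfies `Ψ(0) ≤ Ψ(σ)` for
all `σ` near `0` (with `Ψ(0)` written as `r u(γ 0) + ½ r ∫₀ʳ |γ'|²`). Then
`g(X(0), γ'(0)) ≤ du(X(0))`, and if also `du(X(0)) ≤ g(X(0), γ'(0))` then
`0 ≤ Hess u(X(0),X(0)) + ∫₀ʳ [g(R(X,γ')X,γ') + |D_tX|²]`: expand `Ψ(σ) ≤ r[u(γ0) + σ du(X0) +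
½σ²(Hess u(X0,X0) + ε)] + ½r[E₀ − 2σ g(X0,γ'0) + σ²(I + εr)]` (`integral_energy_le_taylor`,
`integral_val_covariantDerivAlong_velocity`, `exists_le_taylor_two_of_hasDerivAt` for
`σ ↦ u(exp(σX0))` via `hasDerivAt_comp_curve_mvfderiv`,
`hasDerivAt_mvfderiv_velocity_of_isGeodesicOn`)
and compare coefficients. [cite: Brendle2022, Lemmas 2.2–2.3 (proofs)] -/
theorem firstOrder_and_secondVariation_of_minimal (hn : (∞ : ℕ∞ω) ≤ n)
    (hc : IsGeodesicallyComplete g.leviCivita) {γ : ℝ → M} (hγgeo : IsGeodesic g.leviCivita γ)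
    (hγ : ContMDiff 𝓘(ℝ, ℝ) I ∞ γ) {X : Π t : ℝ, TangentSpace I (γ t)}
    (hX : ContMDiff 𝓘(ℝ, ℝ) I.tangent ∞
      (fun t ↦ (TotalSpace.mk' E (γ t) (X t) : TangentBundle I M)))
    {r : ℝ} (hr : 0 < r) (hXr : X r = 0) {u : M → ℝ} (hu : ∀ᶠ y in 𝓝 (γ 0), CMDiffAt 2 u y)
    (hmin : ∀ᶠ (σ : ℝ) in 𝓝 0, r * u (γ 0) + 1 / 2 * r * ∫ t in (0 : ℝ)..r, g.val (γ t)
        (velocity I γ t) (velocity I γ t) ≤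
      r * u (expMap g.leviCivita (γ 0) (σ • X 0)) + 1 / 2 * r *
        ∫ t in (0 : ℝ)..r, g.val (expMap g.leviCivita (γ t) (σ • X t))
          (velocity I (fun t' ↦ expMap g.leviCivita (γ t') (σ • X t')) t)
          (velocity I (fun t' ↦ expMap g.leviCivita (γ t') (σ • X t')) t)) :
    g.val (γ 0) (X 0) (velocity I γ 0) ≤ mvfderiv I u (γ 0) (X 0) ∧
      (mvfderiv I u (γ 0) (X 0) ≤ g.val (γ 0) (X 0) (velocity I γ 0) →
        0 ≤ g.hessian u (γ 0) (X 0) (X 0) + ∫ t in (0 : ℝ)..r,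
          (g.val (γ t) (g.leviCivita.curvature (γ t) (X t) (velocity I γ t) (X t))
            (velocity I γ t) +
            g.val (γ t) (covariantDerivAlong g.leviCivita γ X t)
              (covariantDerivAlong g.leviCivita γ X t))) := by
  haveI : Fact (1 ≤ n) := ⟨le_trans (by exact_mod_cast le_top) hn⟩
  -- Taylor bound for the energy of the variation
  obtain ⟨-, hTX⟩ := integral_energy_le_taylor g hn hc hX hr.le
  -- the first-variation integral
  have hFX : ∫ t in (0 : ℝ)..r, 2 * g.val (γ t) (covariantDerivAlong g.leviCivita γ X t)
      (velocity I γ t) = -2 * g.val (γ 0) (X 0) (velocity I γ 0) := by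
    rw [intervalIntegral.integral_const_mul,
      integral_val_covariantDerivAlong_velocity g hn hγgeo hγ hX 0 r, hXr, map_zero,
      zero_apply]
    ring
  -- the transversal geodesic `c(σ) = exp_{γ 0}(σ X(0))` and `k = u ∘ c`
  set c : ℝ → M := fun σ ↦ expMap g.leviCivita (γ 0) (σ • X 0) with hc_def
  have hcs : ContMDiff 𝓘(ℝ, ℝ) I ∞ c := by
    have h1 := contMDiff_uncurry_expMap_smul_field hc hX
    have h2 : ContMDiff 𝓘(ℝ, ℝ) (𝓘(ℝ, ℝ).prod 𝓘(ℝ, ℝ)) ∞ (fun σ : ℝ ↦ ((0 : ℝ), σ)) :=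
      contMDiff_const.prodMk contMDiff_id
    exact h1.comp h2
  have hgeo_c : IsGeodesic g.leviCivita c :=
    isGeodesic_expMap_smul_of_isGeodesicallyComplete hc (γ 0) (X 0)
  have hc0 : c 0 = γ 0 := by
    show expMap g.leviCivita (γ 0) ((0 : ℝ) • X 0) = γ 0
    rw [zero_smul]; exact expMap_zero (cov := g.leviCivita) (γ 0)
  have hv0 : (velocity I c 0 : E) = (X 0 : E) := velocity_expMap_smul_zero (γ 0) (X 0)
  have hu_c : ∀ᶠ σ in 𝓝 (0 : ℝ), CMDiffAt 2 u (c σ) := by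
    have ht : Tendsto c (𝓝 0) (𝓝 (γ 0)) := by
      rw [← hc0]; exact hcs.continuous.continuousAt
    exact ht.eventually hu
  have hu_c0 : CMDiffAt 2 u (c 0) := hu_c.self_of_nhds
  set k : ℝ → ℝ := fun σ ↦ u (c σ) with hk_def
  set k' : ℝ → ℝ := fun σ ↦ mvfderiv I u (c σ) (velocity I c σ) with hk'_def
  have hk : ∀ᶠ σ in 𝓝 (0 : ℝ), HasDerivAt k (k' σ) σ := hu_c.mono fun σ hσ ↦
    hasDerivAt_comp_curve_mvfderiv (hσ.mdifferentiableAt (by norm_num))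
      ((hcs σ).mdifferentiableAt (by simp))
  have hk' : HasDerivAt k' (g.hessian u (c 0) (velocity I c 0) (velocity I c 0)) 0 :=
    g.hasDerivAt_mvfderiv_velocity_of_isGeodesicOn hgeo_c (mem_univ 0) hu_c0
  -- transport of `du`, `Hess u` from `(c 0, c'(0))` to `(γ 0, X 0)`
  obtain ⟨hdu, hHess⟩ := mvfderiv_hessian_congr_point g (u := u) hc0 hv0
  have hk0 : k 0 = u (γ 0) := congrArg u hc0
  obtain ⟨δk, hδk, hδkb⟩ := Metric.eventually_nhds_iff.1 hk
  have hkI : ∀ σ : ℝ, |σ| < δk → HasDerivAt k (k' σ) σ := fun σ hσ ↦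
    hδkb (by rwa [Real.dist_eq, sub_zero])
  -- abbreviations for the real numbers involved
  set G : ℝ := g.val (γ 0) (X 0) (velocity I γ 0) with hG
  set H₀ : ℝ := g.hessian u (c 0) (velocity I c 0) (velocity I c 0) with hH₀
  set E₀ : ℝ := ∫ t in (0 : ℝ)..r, g.val (γ t) (velocity I γ t) (velocity I γ t) with hE₀
  set Iq : ℝ := ∫ t in (0 : ℝ)..r,
    (g.val (γ t) (g.leviCivita.curvature (γ t) (X t) (velocity I γ t) (X t)) (velocity I γ t) +
      g.val (γ t) (covariantDerivAlong g.leviCivita γ X t)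
        (covariantDerivAlong g.leviCivita γ X t)) with hIq
  -- the expansion: `0 ≤ r (k'(0) - G) + σ (r/2) (H₀ + Iq + ε (1 + r))` for small `σ > 0`
  obtain ⟨δ₀, hδ₀, hδ₀b⟩ := Metric.eventually_nhds_iff.1 hmin
  have hstep : ∀ ε > 0, ∃ δ > 0, ∀ σ ∈ Ioc (0 : ℝ) δ,
      0 ≤ r * (k' 0 - G) + σ * (r / 2 * (H₀ + Iq + ε * (1 + r))) := by
    intro ε hε
    obtain ⟨δ₁, hδ₁, hT⟩ := hTX ε hε
    obtain ⟨δ₂, hδ₂, hTk⟩ := exists_le_taylor_two_of_hasDerivAt (k := k) (k' := k') (H := H₀)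
      (half_pos hδk) (fun σ hσ ↦ hkI σ (by rw [abs_of_nonneg hσ.1]; linarith [hσ.2])) hk' hε
    refine ⟨min (min δ₁ δ₂) (δ₀ / 2), lt_min (lt_min hδ₁ hδ₂) (half_pos hδ₀), fun σ hσ ↦ ?_⟩
    have hσ₁ : σ ∈ Icc (0 : ℝ) δ₁ :=
      ⟨hσ.1.le, hσ.2.trans ((min_le_left _ _).trans (min_le_left _ _))⟩
    have hσ₂ : σ ∈ Icc (0 : ℝ) δ₂ :=
      ⟨hσ.1.le, hσ.2.trans ((min_le_left _ _).trans (min_le_right _ _))⟩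
    have h1 := hδ₀b (y := σ) (by
      rw [Real.dist_eq, sub_zero, abs_of_pos hσ.1]
      exact lt_of_le_of_lt (hσ.2.trans (min_le_right _ _)) (by linarith))
    beta_reduce at h1
    have h2 := hT σ hσ₁
    have h3 := hTk σ hσ₂
    rw [hFX, sub_zero] at h2
    rw [hk0] at h3
    generalize hEσ : (∫ t in (0 : ℝ)..r, g.val (expMap g.leviCivita (γ t) (σ • X t))
          (velocity I (fun t' ↦ expMap g.leviCivita (γ t') (σ • X t')) t)
          (velocity I (fun t' ↦ expMap g.leviCivita (γ t') (σ • X t')) t)) = Eσ at h1 h2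
    have h2' := mul_le_mul_of_nonneg_left h2 (by positivity : (0 : ℝ) ≤ 1 / 2 * r)
    have h3' := mul_le_mul_of_nonneg_left h3 hr.le
    have hkσ : k σ = u (expMap g.leviCivita (γ 0) (σ • X 0)) := rfl
    rw [hkσ] at h3'
    have key : 0 ≤ σ * (r * (k' 0 - G) + σ * (r / 2 * (H₀ + Iq + ε * (1 + r)))) := by
      nlinarith [h1, h2', h3']
    exact (mul_nonneg_iff_of_pos_left hσ.1).1 key
  -- first order: `G ≤ k'(0)`
  have hfirst : G ≤ k' 0 := by
    obtain ⟨δ, hδ, h⟩ := hstep 1 one_pos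
    have h1 : 0 ≤ r * (k' 0 - G) := nonneg_of_forall_Ioc_nonneg_add_mul hδ h
    have h1' := (mul_nonneg_iff_of_pos_left hr).1 h1
    linarith
  refine ⟨by rw [← hdu]; exact hfirst, fun hle ↦ ?_⟩
  -- second order, given `k'(0) ≤ G`
  have heq : k' 0 = G := le_antisymm (by rw [← hdu] at hle; exact hle) hfirst
  have hsecond : ∀ ε ∈ Ioc (0 : ℝ) 1, 0 ≤ (H₀ + Iq) + ε * (1 + r) := by
    intro ε hε
    obtain ⟨δ, hδ, h⟩ := hstep ε hε.1
    have h1 := h δ ⟨hδ, le_rfl⟩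
    rw [heq, sub_self, mul_zero, zero_add] at h1
    have h2 := (mul_nonneg_iff_of_pos_left hδ).1 h1
    have h3 := (mul_nonneg_iff_of_pos_left (by positivity : (0 : ℝ) < r / 2)).1 h2
    linarith
  have hfin : 0 ≤ H₀ + Iq := nonneg_of_forall_Ioc_nonneg_add_mul one_pos hsecond
  rw [← hHess]
  exact hfin

/-- **Brendle 2023, Lemmas 2.2 and 2.3 (first and second variation at a contact point).** With
`γ, X, r, u` as in `firstOrder_and_secondVariation_of_minimal`, if the functional `Ψ` is minimal at
`σ = 0` both for `X` and for `−X` (near `0`), then `du_{γ(0)}(X(0)) = g(X(0), γ'(0))` (Lemma 2.2: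
`∇u(x̄) = γ̄'(0)` when `X(0)` ranges over `T_{x̄}M`) and
`0 ≤ Hess u(X(0), X(0)) + ∫₀ʳ [g(R(X,γ')X,γ') + |D_tX|²]` (Lemma 2.3:
`D²u(X(0),X(0)) + ∫₀ʳ (|D_tX|² − R(γ̄',X,γ̄',X)) ≥ 0`, as `g(R(X,γ')X,γ') = −R(γ',X,γ',X)`).
[cite: Brendle2022, Lemma 2.2 and Lemma 2.3] -/
theorem mvfderiv_eq_and_secondVariation_nonneg_of_minimal (hn : (∞ : ℕ∞ω) ≤ n)
    (hc : IsGeodesicallyComplete g.leviCivita) {γ : ℝ → M} (hγgeo : IsGeodesic g.leviCivita γ)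
    (hγ : ContMDiff 𝓘(ℝ, ℝ) I ∞ γ) {X : Π t : ℝ, TangentSpace I (γ t)}
    (hX : ContMDiff 𝓘(ℝ, ℝ) I.tangent ∞
      (fun t ↦ (TotalSpace.mk' E (γ t) (X t) : TangentBundle I M)))
    {r : ℝ} (hr : 0 < r) (hXr : X r = 0) {u : M → ℝ} (hu : ∀ᶠ y in 𝓝 (γ 0), CMDiffAt 2 u y)
    (hmin : ∀ᶠ (σ : ℝ) in 𝓝 0, r * u (γ 0) + 1 / 2 * r * ∫ t in (0 : ℝ)..r, g.val (γ t)
        (velocity I γ t) (velocity I γ t) ≤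
      r * u (expMap g.leviCivita (γ 0) (σ • X 0)) + 1 / 2 * r *
        ∫ t in (0 : ℝ)..r, g.val (expMap g.leviCivita (γ t) (σ • X t))
          (velocity I (fun t' ↦ expMap g.leviCivita (γ t') (σ • X t')) t)
          (velocity I (fun t' ↦ expMap g.leviCivita (γ t') (σ • X t')) t))
    (hmin' : ∀ᶠ (σ : ℝ) in 𝓝 0, r * u (γ 0) + 1 / 2 * r * ∫ t in (0 : ℝ)..r, g.val (γ t)
        (velocity I γ t) (velocity I γ t) ≤
      r * u (expMap g.leviCivita (γ 0) (σ • ((-1 : ℝ) • X 0))) + 1 / 2 * r *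
        ∫ t in (0 : ℝ)..r, g.val (expMap g.leviCivita (γ t) (σ • ((-1 : ℝ) • X t)))
          (velocity I (fun t' ↦ expMap g.leviCivita (γ t') (σ • ((-1 : ℝ) • X t'))) t)
          (velocity I (fun t' ↦ expMap g.leviCivita (γ t') (σ • ((-1 : ℝ) • X t'))) t)) :
    mvfderiv I u (γ 0) (X 0) = g.val (γ 0) (X 0) (velocity I γ 0) ∧
      0 ≤ g.hessian u (γ 0) (X 0) (X 0) + ∫ t in (0 : ℝ)..r,
        (g.val (γ t) (g.leviCivita.curvature (γ t) (X t) (velocity I γ t) (X t)) (velocity I γ t) +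
          g.val (γ t) (covariantDerivAlong g.leviCivita γ X t)
            (covariantDerivAlong g.leviCivita γ X t)) := by
  obtain ⟨h1, h2⟩ := firstOrder_and_secondVariation_of_minimal g hn hc hγgeo hγ hX hr hXr hu hmin
  -- the opposite field
  have hY : ContMDiff 𝓘(ℝ, ℝ) I.tangent ∞
      (fun t ↦ (TotalSpace.mk' E (γ t) ((-1 : ℝ) • X t) : TangentBundle I M)) := fun t ↦
    HarmonicMap.contMDiffAt_lift_smul (hX t) contMDiffAt_const
  have hYr : (-1 : ℝ) • X r = 0 := by rw [hXr, smul_zero]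
  obtain ⟨h1', -⟩ := firstOrder_and_secondVariation_of_minimal g hn hc hγgeo hγ
    (X := fun t ↦ (-1 : ℝ) • X t) hY hr hYr hu hmin'
  rw [map_smul, smul_apply, smul_eq_mul, map_smul, smul_eq_mul] at h1'
  have hle : mvfderiv I u (γ 0) (X 0) ≤ g.val (γ 0) (X 0) (velocity I γ 0) := by linarith
  exact ⟨le_antisymm hle h1, h2 hle⟩


set_option maxHeartbeats 800000 in
/-- **The contact condition implies minimality of `Ψ`** (Brendle 2023, proof of Lemma 2.1–2.3:
"`r u(x) + ½ d(x,p)² ≥ r u(x̄) + ½ d(x̄,p)²`", with `p = exp_{x̄}(rV)`, `d(x̄,p) = r|V|`,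
`d(exp_{x̄}(σX(0)), p) ≤ L(x_σ) ≤ (r ∫₀ʳ|∂ₜx_σ|²)^{1/2}`). If
`r u(x₀) + ½ (r|V|)² ≤ r u(y) + ½ d(y, exp_{x₀}(rV))²` for all `y` near `x₀`, `X` is a smooth field
along `t ↦ exp_{x₀}(tV)` with `X(r) = 0`, then for all `σ` near `0`,
`r u(γ 0) + ½ r ∫₀ʳ|γ'|² ≤ r u(x_σ(0)) + ½ r ∫₀ʳ |∂ₜ x_σ|²` (`edist_le_length`,
`length_eq_ofReal_integral`, Cauchy–Schwarz `sq_intervalIntegral_le_length_mul_of_continuous`,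
constant speed of `γ`). This is the hypothesis `hmin` of
`mvfderiv_eq_and_secondVariation_nonneg_of_minimal`. [cite: Brendle2022, Lemmas 2.1–2.3 (proofs)] -/
theorem eventually_energy_minimal_of_contact (hn : (∞ : ℕ∞ω) ≤ n) (hg : g.IsRiemannian)
    (hc : IsGeodesicallyComplete g.leviCivita) (x₀ : M) (V : TangentSpace I x₀) {r : ℝ}
    (hr : 0 < r) {X : Π t : ℝ, TangentSpace I (expMap g.leviCivita x₀ (t • V))}
    (hX : ContMDiff 𝓘(ℝ, ℝ) I.tangent ∞
      (fun t ↦ (TotalSpace.mk' E (expMap g.leviCivita x₀ (t • V)) (X t) : TangentBundle I M)))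
    (hXr : X r = 0) {u : M → ℝ}
    (hcontact : ∀ᶠ y in 𝓝 x₀, r * u x₀ + 1 / 2 * (r * Real.sqrt (g.val x₀ V V)) ^ 2 ≤
      r * u y + 1 / 2 * (g.edist hg y (expMap g.leviCivita x₀ (r • V))).toReal ^ 2) :
    ∀ᶠ (σ : ℝ) in 𝓝 0, r * u (expMap g.leviCivita x₀ ((0 : ℝ) • V)) + 1 / 2 * r *
        ∫ t in (0 : ℝ)..r, g.val (expMap g.leviCivita x₀ (t • V))
          (velocity I (fun t ↦ expMap g.leviCivita x₀ (t • V)) t)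
          (velocity I (fun t ↦ expMap g.leviCivita x₀ (t • V)) t) ≤
      r * u (expMap g.leviCivita (expMap g.leviCivita x₀ ((0 : ℝ) • V)) (σ • X 0)) + 1 / 2 * r *
        ∫ t in (0 : ℝ)..r, g.val (expMap g.leviCivita (expMap g.leviCivita x₀ (t • V)) (σ • X t))
          (velocity I (fun t' ↦ expMap g.leviCivita (expMap g.leviCivita x₀ (t' • V)) (σ • X t')) t)
          (velocity I (fun t' ↦ expMap g.leviCivita (expMap g.leviCivita x₀ (t' • V)) (σ • X t'))
            t) := by
  haveI : Fact (1 ≤ n) := ⟨le_trans (by exact_mod_cast le_top) hn⟩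
  have hnn : ∀ (y : M) (v' : TangentSpace I y), 0 ≤ g.val y v' v' := fun y v' ↦ by
    by_cases hv : v' = 0
    · subst hv; simp
    · exact (hg y v' hv).le
  -- the variation `x t σ = exp_{γ t}(σ X t)` and its smoothness
  set x : ℝ → ℝ → M := fun t σ ↦
    expMap g.leviCivita (expMap g.leviCivita x₀ (t • V)) (σ • X t) with hx_def
  have hx : ContMDiff (𝓘(ℝ, ℝ).prod 𝓘(ℝ, ℝ)) I ∞ (uncurry x) :=
    contMDiff_uncurry_expMap_smul_field hc hX
  -- the geodesic `γ` and its energy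
  have hgeo : IsGeodesic g.leviCivita (fun t ↦ expMap g.leviCivita x₀ (t • V)) :=
    isGeodesic_expMap_smul_of_isGeodesicallyComplete hc x₀ V
  have hγ0 : expMap g.leviCivita x₀ ((0 : ℝ) • V) = x₀ := by
    rw [zero_smul]; exact expMap_zero (cov := g.leviCivita) x₀
  have hspeed : ∀ t, g.val (expMap g.leviCivita x₀ (t • V))
      (velocity I (fun t ↦ expMap g.leviCivita x₀ (t • V)) t)
      (velocity I (fun t ↦ expMap g.leviCivita x₀ (t • V)) t) = g.val x₀ V V := by
    intro t
    have h := g.val_velocity_eq_of_isGeodesicOn_holds isOpen_univ ordConnected_univ hgeo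
      (mem_univ t) (mem_univ 0)
    have hv0 : (velocity I (fun t ↦ expMap g.leviCivita x₀ (t • V)) 0 : E) = (V : E) :=
      velocity_expMap_smul_zero x₀ V
    have h' : g.val (expMap g.leviCivita x₀ (t • V))
        (velocity I (fun t ↦ expMap g.leviCivita x₀ (t • V)) t)
        (velocity I (fun t ↦ expMap g.leviCivita x₀ (t • V)) t) =
        g.val (expMap g.leviCivita x₀ ((0 : ℝ) • V))
          (velocity I (fun t ↦ expMap g.leviCivita x₀ (t • V)) 0)
          (velocity I (fun t ↦ expMap g.leviCivita x₀ (t • V)) 0) := h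
    rw [h', hv0, hγ0]
  have hE₀ : ∫ t in (0 : ℝ)..r, g.val (expMap g.leviCivita x₀ (t • V))
      (velocity I (fun t ↦ expMap g.leviCivita x₀ (t • V)) t)
      (velocity I (fun t ↦ expMap g.leviCivita x₀ (t • V)) t) = r * g.val x₀ V V := by
    simp_rw [hspeed]
    rw [intervalIntegral.integral_const, smul_eq_mul, sub_zero]
  -- the free endpoint `y σ = x 0 σ → x₀`
  have hy : Tendsto (fun σ : ℝ ↦ x 0 σ) (𝓝 0) (𝓝 x₀) := by
    have h1 : Continuous (fun σ : ℝ ↦ x 0 σ) :=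
      hx.continuous.comp (continuous_const.prodMk continuous_id)
    have h2 : x 0 0 = x₀ := by
      show expMap g.leviCivita (expMap g.leviCivita x₀ ((0 : ℝ) • V)) ((0 : ℝ) • X 0) = x₀
      have h3 : (0 : ℝ) • X 0 = 0 := zero_smul _ _
      rw [h3, expMap_zero (cov := g.leviCivita)]
      exact hγ0
    have h4 := h1.continuousAt (x := 0)
    rw [ContinuousAt, h2] at h4
    exact h4
  filter_upwards [hy.eventually hcontact] with σ hσ
  -- the curve `t ↦ x t σ` from `y σ` to `γ r`
  have hline : ContMDiff 𝓘(ℝ, ℝ) (𝓘(ℝ, ℝ).prod 𝓘(ℝ, ℝ)) ∞ (fun t : ℝ ↦ ((t, σ) : ℝ × ℝ)) :=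
    contMDiff_id.prodMk contMDiff_const
  have hγσ : ContMDiff 𝓘(ℝ, ℝ) I ∞ (fun t ↦ x t σ) := hx.comp hline
  have hTl := contMDiff_lift_velocity_of_contMDiff (I := I) hγσ
  have hfc : Continuous fun t ↦ g.val (x t σ) (velocity I (fun t' ↦ x t' σ) t)
      (velocity I (fun t' ↦ x t' σ) t) :=
    (show ContMDiff 𝓘(ℝ, ℝ) 𝓘(ℝ, ℝ) ∞ _ from
      fun t ↦ contMDiffAt_val_apply_along g hn (hTl t) (hTl t)).continuous
  have h1le : (1 : ℕ∞ω) ≤ ∞ := by exact_mod_cast le_top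
  have hc₁ : ContMDiffOn 𝓘(ℝ, ℝ) I 1 (fun t ↦ x t σ) (Icc 0 r) := (hγσ.of_le h1le).contMDiffOn
  have er : x r σ = expMap g.leviCivita x₀ (r • V) := by
    show expMap g.leviCivita (expMap g.leviCivita x₀ (r • V)) (σ • X r) =
      expMap g.leviCivita x₀ (r • V)
    rw [hXr, smul_zero]
    exact expMap_zero (cov := g.leviCivita) _
  -- `d(y σ, γ r) ≤ L ≤ √(r E)`
  have hdle : g.edist hg (x 0 σ) (expMap g.leviCivita x₀ (r • V)) ≤
      g.length hg (fun t ↦ x t σ) 0 r := by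
    have h := g.edist_le_length hg hr.le hc₁
    rwa [er] at h
  have hL := length_eq_ofReal_integral g hg hr.le hfc
  have hℓ : 0 ≤ ∫ t in (0 : ℝ)..r, Real.sqrt (g.val (x t σ) (velocity I (fun t' ↦ x t' σ) t)
      (velocity I (fun t' ↦ x t' σ) t)) :=
    intervalIntegral.integral_nonneg hr.le fun t _ ↦ Real.sqrt_nonneg _
  have hdreal : (g.edist hg (x 0 σ) (expMap g.leviCivita x₀ (r • V))).toReal ≤
      ∫ t in (0 : ℝ)..r, Real.sqrt (g.val (x t σ) (velocity I (fun t' ↦ x t' σ) t)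
        (velocity I (fun t' ↦ x t' σ) t)) := by
    rw [hL] at hdle
    exact ENNReal.toReal_le_of_le_ofReal hℓ hdle
  have hsc : Continuous fun t ↦ Real.sqrt (g.val (x t σ) (velocity I (fun t' ↦ x t' σ) t)
      (velocity I (fun t' ↦ x t' σ) t)) := Real.continuous_sqrt.comp hfc
  have hCS := sq_intervalIntegral_le_length_mul_of_continuous hsc hr.le
  have hsq : (fun t ↦ Real.sqrt (g.val (x t σ) (velocity I (fun t' ↦ x t' σ) t)
      (velocity I (fun t' ↦ x t' σ) t)) ^ 2) =
      fun t ↦ g.val (x t σ) (velocity I (fun t' ↦ x t' σ) t) (velocity I (fun t' ↦ x t' σ) t) :=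
    funext fun t ↦ Real.sq_sqrt (hnn _ _)
  rw [hsq, sub_zero] at hCS
  -- combine with the contact inequality at `y σ`
  have hcon : r * u x₀ + 1 / 2 * (r * Real.sqrt (g.val x₀ V V)) ^ 2 ≤
      r * u (x 0 σ) + 1 / 2 * (g.edist hg (x 0 σ) (expMap g.leviCivita x₀ (r • V))).toReal ^ 2 :=
    hσ
  have hsqV : (r * Real.sqrt (g.val x₀ V V)) ^ 2 = r * (r * g.val x₀ V V) := by
    rw [mul_pow, Real.sq_sqrt (hnn x₀ V)]; ring
  have hd0 : 0 ≤ (g.edist hg (x 0 σ) (expMap g.leviCivita x₀ (r • V))).toReal :=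
    ENNReal.toReal_nonneg
  have hdsq : (g.edist hg (x 0 σ) (expMap g.leviCivita x₀ (r • V))).toReal ^ 2 ≤
      r * ∫ t in (0 : ℝ)..r, g.val (x t σ) (velocity I (fun t' ↦ x t' σ) t)
        (velocity I (fun t' ↦ x t' σ) t) :=
    (pow_le_pow_left₀ hd0 hdreal 2).trans hCS
  rw [hsqV] at hcon
  rw [congrArg u hγ0, hE₀]
  show r * u x₀ + 1 / 2 * r * (r * g.val x₀ V V) ≤ r * u (x 0 σ) + 1 / 2 * r *
    ∫ t in (0 : ℝ)..r, g.val (x t σ) (velocity I (fun t' ↦ x t' σ) t)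
      (velocity I (fun t' ↦ x t' σ) t)
  nlinarith [hcon, hdsq, hr]

end SecondVariation

end Literature.Geometry.Riemannian
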